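import Mathlib
import HarnessLib
import Summits.Langlands.Langlands.Theorems.SplitPrimeDescentLadder
import Summits.Langlands.Langlands.Theorems.SplitPrimeDescentLadderResidual
import Literature.NumberTheory.GaloisRepresentations.ArtinReciprocityCharacterProofs
import Literature.NumberTheory.GaloisRepresentations.AbsGaloisOuterConj
import Literature.NumberTheory.GaloisRepresentations.ArtinRestriction
import Literature.NumberTheory.Automorphic.StrongArtinGL2
import Summits.Langlands.Langlands.Theorems.SplitPrimeDescentLadderTwistModelPrelude


/-!
# `SplitPrimeDescentLadder` v3 — D∞' `CofinalResidualDoor`, stub **T2 `stub_twistModel` PROVED**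

Node `SplitPrimeDescentLadder` (decomp-langlands lens-1, blocker stmt-Langlands-14077
`EvenIcosahedralCMCorner.SolubleDescentMatching`), piece D∞' = tree decl
`Summit.Langlands.Langlands.Theorems.SplitPrimeDescentLadder.CofinalResidualDoor`
(`Theorems/SplitPrimeDescentLadderResidual.lean`).  Its BC3 afterbirth (g34/v3, sha256 28fd805ea7883c6e,
CLEARED critic row 461) has three stubs T1 `stub_fieldSupply`, T2 `stub_twistModel`, T3 `stub_residualSerreDoor`
and the composition `CofinalResidualDoor_of : T1 → T2 → T3 → CofinalResidualDoor`.

This file proves **T2 verbatim** (`twistModel_holds`, statement textually identical to `stub_twistModel`, the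
helper defs `FieldClauses` / `ThreeSplit` / `GaloisClauses` verbatim from the afterbirth), with `χ = 1`,
`τ = σ|_M`, `τ₃ = GL₂(ι⁻¹) ∘ σ|_M`.  Ingredients:
* part C (`norm_sub_eq_one_of_rootsOfUnity`): in `\bar ℚ₃`, roots of unity `a ≠ b` with `a ^ 60 = b ^ 60` and
  `a² + ab + b² ≠ 0` have `‖a - b‖ = 1` — elementary ultrametric argument (`‖20‖₃ = 1`, geometric sums);
* part A (`eig_pow_eq`): Cayley–Hamilton for split `2 × 2` characteristic polynomials, `A ^ k = c ⇒ a ^ k = c`;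
* part B (`map_eq_range_of_commutator_le`, `commutator_le_range_absGaloisRestrict`): `A₅` is perfect and
  `⁅Γ_ℚ, Γ_ℚ⁆ ≤ res(Γ_M)` for `M/ℚ` cyclic, so the projective image of `σ|_M` is all of `A₅`;
* coefficient transport (local copies of the folklore lemmas of ArtinRepCoefficientTransport), tree lemmas `isUnramifiedAt_restrictField` /
  `hasFrobCharpolyAt_restrictField_fin_two` (ArtinRestriction), `finite_range_toMonoidHom` (StrongArtinGL2),
  `FramedArtinRep.isOpen_ker_toMonoidHom`, `absGaloisQuot_eq_one_iff` (AbsGaloisOuterConj).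
After this file D∞' ⟸ T1 (field supply, ATTACKABLE) ∧ T3 (residual Serre door, IDEA-NEEDED).
-/

set_option linter.dupNamespace false

namespace Summit.Langlands.Langlands.Theorems.SplitPrimeDescentLadder.V3Birth.CofinalResidualDoor

open Finset
open Polynomial

/-! ## T2 — the twist model, assembled -/

section Main

open NumberField IsDedekindDomain Filter Polynomial
open Literature.NumberTheory.GaloisRepresentations Literature.NumberTheory.Automorphic

/-- FIELD clauses of D∞ for the member at `p` (verbatim): `M` CM, Galois, cyclic, squarefree degree with odd prime
divisors in the window `[2^p, 2^(p+1))`, `p` split completely, `√-d ∈ M` with `d ≡ 2 (mod 3)`, `ζ₃ ∉ M`. [folklore] -/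
def FieldClauses (p : IsDedekindDomain.HeightOneSpectrum (NumberField.RingOfIntegers ℚ)) (M : Type) [Field M] [NumberField M] : Prop :=
  NumberField.IsCMField M ∧ IsGalois ℚ M ∧ IsCyclic (M ≃ₐ[ℚ] M) ∧ Squarefree (Module.finrank ℚ M) ∧ (∀ ℓ : ℕ, ℓ.Prime → ℓ ∣ Module.finrank ℚ M → ℓ = 2 ∨ (2 ^ Ideal.absNorm p.asIdeal ≤ ℓ ∧ ℓ < 2 ^ (Ideal.absNorm p.asIdeal + 1))) ∧ (∀ w : IsDedekindDomain.HeightOneSpectrum (NumberField.RingOfIntegers M), w.asIdeal.under (NumberField.RingOfIntegers ℚ) = p.asIdeal → w.asIdeal.inertiaDeg (NumberField.RingOfIntegers ℚ) = 1 ∧ w.asIdeal.ramificationIdx (NumberField.RingOfIntegers ℚ) = 1) ∧ (∃ (d : ℕ) (z : M), d % 3 = 2 ∧ z ^ 2 + (d : M) = 0) ∧ (∀ z : M, z ^ 2 + z + 1 ≠ 0)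

/-- `3` splits completely in `M` (residue degree and ramification index `1` at every place above `3`). [folklore] -/
def ThreeSplit (M : Type) [Field M] [NumberField M] : Prop :=
  ∀ w : IsDedekindDomain.HeightOneSpectrum (NumberField.RingOfIntegers M), (3 : NumberField.RingOfIntegers M) ∈ w.asIdeal → w.asIdeal.inertiaDeg (NumberField.RingOfIntegers ℚ) = 1 ∧ w.asIdeal.ramificationIdx (NumberField.RingOfIntegers ℚ) = 1

/-- GALOIS clauses of D∞ (verbatim): `τ = χ ⊗ σ|_M` entrywise, `τ₃` a `3`-adic `ι`-model of `τ` with finite image,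
`χ, τ₃` unramified above `p`, `τ₃` projectively `A₅`, `τ₃` unramified and `3`-adically distinguished above `3`. [folklore] -/
def GaloisClauses (ι : PadicAlgCl 3 ≃+* ℂ) (σ : Literature.NumberTheory.GaloisRepresentations.FramedGaloisRep ℚ ℂ 2)
    (p : IsDedekindDomain.HeightOneSpectrum (NumberField.RingOfIntegers ℚ)) (M : Type) [Field M] [NumberField M]
    (χ : Literature.NumberTheory.GaloisRepresentations.FramedGaloisRep M ℂ 1)
    (τ : Literature.NumberTheory.GaloisRepresentations.FramedGaloisRep M ℂ 2)
    (τ₃ : Literature.NumberTheory.GaloisRepresentations.FramedGaloisRep M (PadicAlgCl 3) 2) : Prop :=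
  (∀ g : Field.absoluteGaloisGroup M, ((τ g : Matrix.GeneralLinearGroup (Fin 2) ℂ) : Matrix (Fin 2) (Fin 2) ℂ) = ((Matrix.GeneralLinearGroup.det (χ g) : ℂˣ) : ℂ) • ((Literature.NumberTheory.GaloisRepresentations.FramedGaloisRep.restrictField M σ g : Matrix.GeneralLinearGroup (Fin 2) ℂ) : Matrix (Fin 2) (Fin 2) ℂ)) ∧ (∀ g : Field.absoluteGaloisGroup M, ((τ₃ g : Matrix.GeneralLinearGroup (Fin 2) (PadicAlgCl 3)) : Matrix (Fin 2) (Fin 2) (PadicAlgCl 3)).map ι = ((τ g : Matrix.GeneralLinearGroup (Fin 2) ℂ) : Matrix (Fin 2) (Fin 2) ℂ)) ∧ Finite τ₃.toMonoidHom.range ∧ (∀ w : IsDedekindDomain.HeightOneSpectrum (NumberField.RingOfIntegers M), w.asIdeal.under (NumberField.RingOfIntegers ℚ) = p.asIdeal → χ.IsUnramifiedAt w ∧ τ₃.IsUnramifiedAt w) ∧ Nonempty ((Matrix.ProjGenLinGroup.mk.comp τ₃.toMonoidHom).range ≃* alternatingGroup (Fin 5)) ∧ (∀ w : IsDedekindDomain.HeightOneSpectrum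 (NumberField.RingOfIntegers M), (3 : NumberField.RingOfIntegers M) ∈ w.asIdeal → τ₃.IsUnramifiedAt w ∧ ∃ t d : PadicAlgCl 3, τ₃.HasFrobCharpolyAt w (Polynomial.X ^ 2 - Polynomial.C t * Polynomial.X + Polynomial.C d) ∧ ‖t ^ 2 - 4 * d‖ = 1)

/-- **T2 `stub_twistModel` PROVED** — GALOIS LAYER, uniform in `M`: `χ = 1`, `τ = σ|_M`, `τ₃ = ι⁻¹ ∘ σ|_M` work.
Finite image and unramifiedness are transported along `GL₂(ι⁻¹)`; the projective image of `σ|_M` is still `A₅`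
because `⁅Γ_ℚ, Γ_ℚ⁆ ≤ Γ_M` (`M/ℚ` cyclic) and `A₅` is perfect; at `w ∣ 3` (split, `f = 1`) the Frobenius
polynomial restricts unchanged, and `‖t² - 4d‖₃ = 1` because the eigenvalue ratio `ζ = a/b` satisfies
`ζ ^ 60 = 1` (projective order divides `|A₅| = 60`), `ζ ≠ 1` (`t² ≠ 4d`), `ζ² + ζ + 1 ≠ 0` (`t² ≠ d`).
[DeligneSerre1974 §8; folklore] -/
theorem twistModel_holds :
    ∀ (ι : PadicAlgCl 3 ≃+* ℂ) (σ : Literature.NumberTheory.GaloisRepresentations.FramedGaloisRep ℚ ℂ 2), Nonempty ((Matrix.ProjGenLinGroup.mk.comp σ.toMonoidHom).range ≃* alternatingGroup (Fin 5)) → (∀ v : IsDedekindDomain.HeightOneSpectrum (NumberField.RingOfIntegers ℚ), (3 : NumberField.RingOfIntegers ℚ) ∈ v.asIdeal → σ.IsUnramifiedAt v ∧ ∃ t d : ℂ, σ.HasFrobCharpolyAt v (Polynomial.X ^ 2 - Polynomial.C t * Polynomial.X + Polynomial.C d) ∧ t ^ 2 ≠ d ∧ t ^ 2 ≠ 4 *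 d) → ∀ p : IsDedekindDomain.HeightOneSpectrum (NumberField.RingOfIntegers ℚ), σ.IsUnramifiedAt p → ∀ (M : Type) [Field M] [NumberField M], FieldClauses p M → ThreeSplit M → ∃ (χ : Literature.NumberTheory.GaloisRepresentations.FramedGaloisRep M ℂ 1) (τ : Literature.NumberTheory.GaloisRepresentations.FramedGaloisRep M ℂ 2) (τ₃ : Literature.NumberTheory.GaloisRepresentations.FramedGaloisRep M (PadicAlgCl 3) 2), GaloisClauses ι σ p M χ τ τ₃ := by
  intro ι σ hA5 h3 p hσp M _ _ hFC h3split
  classical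
  obtain ⟨e⟩ := hA5
  haveI : IsGalois ℚ M := hFC.2.1
  haveI : IsCyclic (M ≃ₐ[ℚ] M) := hFC.2.2.1
  -- the coefficient isomorphism `ℂ → \bar ℚ₃`
  set φ : ℂ →+* PadicAlgCl 3 := (ι.symm : ℂ ≃+* PadicAlgCl 3).toRingHom with hφ
  have hφapp : ∀ x, φ x = ι.symm x := fun x => rfl
  have hιφ : ∀ x, ι (φ x) = x := fun x => by rw [hφapp]; exact ι.apply_symm_apply x
  -- the 3-adic model of `σ|_M`
  have hopen : IsOpen (((FramedGaloisRep.restrictField M σ : FramedGaloisRep M ℂ 2) :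
      Field.absoluteGaloisGroup M →* GL (Fin 2) ℂ).ker : Set (Field.absoluteGaloisGroup M)) :=
    FramedArtinRep.isOpen_ker_toMonoidHom (K := M) (n := 2) (FramedGaloisRep.restrictField M σ)
  obtain ⟨τ₃, hτ₃⟩ := exists_map_of_isOpen_ker' (FramedGaloisRep.restrictField M σ) hopen φ
  -- census inline (G40 hygiene): the two coefficient-transport one-liners of
  -- `Literature…ArtinRepCoefficientTransport` (module unbuilt on the farm; `dedup.landed` forbids local decl copies)
  have hunr_map : ∀ {v}, (FramedGaloisRep.restrictField M σ).IsUnramifiedAt v → τ₃.IsUnramifiedAt v :=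
    fun h 𝔓 h𝔓 g hg => by rw [hτ₃ g, h 𝔓 h𝔓 g hg, map_one]
  have hchar_map : ∀ {v} {P : Polynomial ℂ}, (FramedGaloisRep.restrictField M σ).HasFrobCharpolyAt v P →
      τ₃.HasFrobCharpolyAt v (P.map φ) := by
    intro v P h 𝔓 h𝔓 g hg
    have e := h 𝔓 h𝔓 g hg
    unfold FramedRep.charpoly at e ⊢
    have hmat : ((τ₃ g : GL (Fin 2) (PadicAlgCl 3)) : Matrix (Fin 2) (Fin 2) (PadicAlgCl 3)) =
        (((FramedGaloisRep.restrictField M σ) g : GL (Fin 2) ℂ) : Matrix (Fin 2) (Fin 2) ℂ).map φ := by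
      ext i j
      rw [hτ₃ g, Matrix.GeneralLinearGroup.map_apply, Matrix.map_apply]
    rw [hmat, Matrix.charpoly_map, e]
  refine ⟨1, FramedGaloisRep.restrictField M σ, τ₃, ?_⟩
  unfold GaloisClauses
  refine ⟨?_, ?_, ?_, ?_, ?_, ?_⟩
  · -- (G1) `τ = det(χ) • σ|_M` with `χ = 1`
    intro g
    simp only [ContinuousMonoidHom.coe_one, Pi.one_apply, map_one, Units.val_one, one_smul]
  · -- (G2) `τ₃` is an `ι`-model of `τ`
    intro g
    ext i j
    rw [Matrix.map_apply, hτ₃ g, Matrix.GeneralLinearGroup.map_apply, hιφ]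
  · -- (G3) finite image
    haveI : Finite (FramedGaloisRep.restrictField M σ).toMonoidHom.range :=
      finite_range_toMonoidHom (F := M) (n := 2) (FramedGaloisRep.restrictField M σ)
    refine Finite.of_surjective
      (fun x : (FramedGaloisRep.restrictField M σ).toMonoidHom.range =>
        (⟨Matrix.GeneralLinearGroup.map φ x.1, by
          obtain ⟨g, hg⟩ := MonoidHom.mem_range.1 x.2
          exact MonoidHom.mem_range.2 ⟨g, by rw [← hg]; exact hτ₃ g⟩⟩ : τ₃.toMonoidHom.range)) ?_
    rintro ⟨y, hy⟩
    obtain ⟨g, rfl⟩ := MonoidHom.mem_range.1 hy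
    exact ⟨⟨FramedGaloisRep.restrictField M σ g, MonoidHom.mem_range.2 ⟨g, rfl⟩⟩, Subtype.ext (hτ₃ g).symm⟩
  · -- (G4) unramified above `p`
    intro w hw
    exact ⟨fun _ _ _ _ => rfl,
      hunr_map (FramedGaloisRep.isUnramifiedAt_restrictField σ hw hσp)⟩
  · -- (G5) projective image still `A₅`
    have hτmh : (Matrix.ProjGenLinGroup.mk.comp (FramedGaloisRep.restrictField M σ).toMonoidHom) =
        (Matrix.ProjGenLinGroup.mk.comp σ.toMonoidHom).comp (absGaloisRestrict ℚ M).toMonoidHom := by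
      ext g; rfl
    have hrange : (Matrix.ProjGenLinGroup.mk.comp (FramedGaloisRep.restrictField M σ).toMonoidHom).range =
        (Matrix.ProjGenLinGroup.mk.comp σ.toMonoidHom).range := by
      rw [hτmh, MonoidHom.range_comp]
      exact map_eq_range_of_commutator_le _ _ (commutator_le_range_absGaloisRestrict ℚ M) e
    have hτ₃mh : (Matrix.ProjGenLinGroup.mk.comp τ₃.toMonoidHom) =
        (Matrix.ProjGenLinGroup.map φ).comp
          (Matrix.ProjGenLinGroup.mk.comp (FramedGaloisRep.restrictField M σ).toMonoidHom) := by
      ext g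
      simp only [MonoidHom.comp_apply, Matrix.ProjGenLinGroup.map_mk]
      exact congrArg Matrix.ProjGenLinGroup.mk (hτ₃ g)
    have hcomp : ((ι : PadicAlgCl 3 ≃+* ℂ).toRingHom.comp φ) = RingHom.id ℂ := by
      ext x; exact hιφ x
    have hinj : Function.Injective (Matrix.ProjGenLinGroup.map (n := Fin 2) φ) := by
      intro x y hxy
      have h' := congrArg (Matrix.ProjGenLinGroup.map (n := Fin 2) (ι : PadicAlgCl 3 ≃+* ℂ).toRingHom) hxy
      simp only [← MonoidHom.comp_apply, ← Matrix.ProjGenLinGroup.map_comp, hcomp,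
        Matrix.ProjGenLinGroup.map_id, MonoidHom.id_apply] at h'
      exact h'
    rw [hτ₃mh, MonoidHom.range_comp, hrange]
    exact ⟨((Matrix.ProjGenLinGroup.mk.comp σ.toMonoidHom).range.equivMapOfInjective _ hinj).symm.trans e⟩
  · -- (G6) unramified and `3`-adically distinguished above `3`
    intro w hw3
    have hw : w.asIdeal.under (𝓞 ℚ) = (w.under (𝓞 ℚ)).asIdeal := rfl
    have hv3 : (3 : 𝓞 ℚ) ∈ (w.under (𝓞 ℚ)).asIdeal := by
      rw [← hw, Ideal.under_def, Ideal.mem_comap, map_ofNat]; exact hw3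
    obtain ⟨hσv, t, d, hP, htd, ht4d⟩ := h3 _ hv3
    have hf : w.asIdeal.inertiaDeg (𝓞 ℚ) = 1 := (h3split w hw3).1
    -- split the Frobenius polynomial over `ℂ`
    obtain ⟨s, hs⟩ := IsAlgClosed.exists_eq_mul_self (t ^ 2 - 4 * d)
    set a : ℂ := (t + s) / 2 with ha
    set b : ℂ := (t - s) / 2 with hb
    have hab_sum : a + b = t := by rw [ha, hb]; ring
    have hab_prod : a * b = d := by
      have h1 : a * b = (t ^ 2 - s * s) / 4 := by rw [ha, hb]; ring
      rw [h1, ← hs]; ring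
    have hPab : (X ^ 2 - C t * X + C d : ℂ[X]) = (X - C a) * (X - C b) := by
      rw [← hab_sum, ← hab_prod, C_add, C_mul]; ring
    have hP' : σ.HasFrobCharpolyAt (w.under (𝓞 ℚ)) ((X - C a) * (X - C b)) := hPab ▸ hP
    have hab : a ≠ b := by
      intro h
      apply ht4d
      have h1 : t ^ 2 - 4 * d = (a - b) ^ 2 := by rw [← hab_sum, ← hab_prod]; ring
      rw [← sub_eq_zero, h1, h, sub_self, zero_pow two_ne_zero]
    have h3ab : a ^ 2 + a * b + b ^ 2 ≠ 0 := by
      intro h; apply htd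
      have h1 : t ^ 2 - d = a ^ 2 + a * b + b ^ 2 := by rw [← hab_sum, ← hab_prod]; ring
      rw [← sub_eq_zero, h1, h]
    -- a Frobenius element at `v ∣ 3` and its matrix
    obtain ⟨𝔓, h𝔓⟩ := (w.under (𝓞 ℚ)).primesAbove_nonempty
    obtain ⟨g0, hg0⟩ := IsDedekindDomain.HeightOneSpectrum.exists_isArithFrobAt_of_mem_primesAbove_holds h𝔓
    have hch : ((σ g0 : GL (Fin 2) ℂ) : Matrix (Fin 2) (Fin 2) ℂ).charpoly = (X - C a) * (X - C b) :=
      hP' 𝔓 h𝔓 g0 hg0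
    -- finite order of `σ g0`
    haveI hfinσ : Finite σ.toMonoidHom.range := finite_range_toMonoidHom (F := ℚ) (n := 2) σ
    have hn0 : Nat.card σ.toMonoidHom.range ≠ 0 := Nat.card_pos.ne'
    have hgn : (σ g0) ^ Nat.card σ.toMonoidHom.range = 1 := by
      have h1 := pow_card_eq_one' (G := σ.toMonoidHom.range) (x := ⟨σ g0, MonoidHom.mem_range.2 ⟨g0, rfl⟩⟩)
      have h2 := congrArg Subtype.val h1
      rwa [Subgroup.coe_pow, Subgroup.coe_one] at h2
    have hAn : ((σ g0 : GL (Fin 2) ℂ) : Matrix (Fin 2) (Fin 2) ℂ) ^ Nat.card σ.toMonoidHom.range = (1 : ℂ) • 1 := by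
      rw [one_smul, ← Units.val_pow_eq_pow_val, hgn, Units.val_one]
    have han : a ^ Nat.card σ.toMonoidHom.range = 1 := eig_pow_eq hch hab hAn
    have hbn : b ^ Nat.card σ.toMonoidHom.range = 1 := eig_pow_eq' hch hab hAn
    -- projective order divides `60`: `(σ g0) ^ 60` is central, hence scalar
    have h60 : (Matrix.ProjGenLinGroup.mk (σ g0)) ^ 60 = 1 := by
      have hmem : Matrix.ProjGenLinGroup.mk (σ g0) ∈ (Matrix.ProjGenLinGroup.mk.comp σ.toMonoidHom).range :=
        MonoidHom.mem_range.2 ⟨g0, rfl⟩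
      have h1 := pow_card_eq_one' (G := (Matrix.ProjGenLinGroup.mk.comp σ.toMonoidHom).range) (x := ⟨_, hmem⟩)
      rw [natCard_eq_sixty_of_mulEquiv_alternatingGroup e] at h1
      have h2 := congrArg Subtype.val h1
      rwa [Subgroup.coe_pow, Subgroup.coe_one] at h2
    have hcen : (σ g0) ^ 60 ∈ Subgroup.center (GL (Fin 2) ℂ) := by
      rw [← Matrix.ProjGenLinGroup.mk_eq_one, map_pow]; exact h60
    obtain ⟨c, hc⟩ := Matrix.GeneralLinearGroup.mem_center_iff_val_mem_range_scalar.1 hcen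
    have hA60 : ((σ g0 : GL (Fin 2) ℂ) : Matrix (Fin 2) (Fin 2) ℂ) ^ 60 = c • 1 := by
      rw [← Units.val_pow_eq_pow_val, ← hc, Matrix.scalar_apply, ← Matrix.smul_one_eq_diagonal]
    have ha60 : a ^ 60 = c := eig_pow_eq hch hab hA60
    have hb60 : b ^ 60 = c := eig_pow_eq' hch hab hA60
    -- restriction to `M` (`f = 1`) and `3`-adic transport of the Frobenius polynomial
    have hPτ : (FramedGaloisRep.restrictField M σ).HasFrobCharpolyAt w ((X - C a) * (X - C b)) := by
      have h1 := FramedGaloisRep.hasFrobCharpolyAt_restrictField_fin_two (E := M) σ hw hσv hP'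
      rwa [hf, pow_one, pow_one] at h1
    have hPτ₃ : τ₃.HasFrobCharpolyAt w (((X - C a) * (X - C b)).map φ) :=
      hchar_map hPτ
    have hmapP : (((X - C a) * (X - C b) : ℂ[X])).map φ = X ^ 2 - C (φ a + φ b) * X + C (φ a * φ b) := by
      simp only [Polynomial.map_mul, Polynomial.map_sub, Polynomial.map_X, Polynomial.map_C, C_add, C_mul]
      ring
    rw [hmapP] at hPτ₃
    refine ⟨hunr_map
        (FramedGaloisRep.isUnramifiedAt_restrictField σ hw hσv), φ a + φ b, φ a * φ b, hPτ₃, ?_⟩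
    -- the norm
    have hsq : (φ a + φ b) ^ 2 - 4 * (φ a * φ b) = (φ a - φ b) ^ 2 := by ring
    have h3ab' : φ a ^ 2 + φ a * φ b + φ b ^ 2 ≠ 0 := by
      have h1 : φ a ^ 2 + φ a * φ b + φ b ^ 2 = φ (a ^ 2 + a * b + b ^ 2) := by
        simp only [map_add, map_mul, map_pow]
      rw [h1]
      exact (map_ne_zero φ).2 h3ab
    rw [hsq, norm_pow, norm_sub_eq_one_of_rootsOfUnity hn0 (by rw [← map_pow, han, map_one])
      (by rw [← map_pow, hbn, map_one]) (by rw [← map_pow, ← map_pow, ha60, hb60])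
      (fun h => hab (φ.injective h)) h3ab', one_pow]

end Main

end Summit.Langlands.Langlands.Theorems.SplitPrimeDescentLadder.V3Birth.CofinalResidualDoor
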